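import Literature.NumberTheory.Automorphic.Liu2021.AppendixC.AlbaneseCocycle
import Literature.NumberTheory.Automorphic.Liu2021.NablaOfPieces
import HarnessLib

/-!
# Liu 2021 §2.1: the Albanese morphism of a SPLIT scheme is a cocycle

[Liu2021] = Yifeng Liu, *Fourier–Jacobi cycles and arithmetic relative trace formula*, Camb. J. Math. **9** (2021)
= arXiv:2102.11518 (v2 numbering; `l. NNNN` = lines of `FJcycle.tex`, as in `AppendixC/Glue.lean`).  Proof of the
Proposition of §2.1 (l. 1194–1200): for a split scheme `X' = ⊔ᵢ Xᵢ` (finite coproduct of geometrically irreducible pieces),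
«`∇_{k'}X' = ⊔ᵢ Xᵢ × Xᵢ`» and the Albanese morphism restricts on each `Xᵢ × Xᵢ` to (a homomorphic image of) Serre's /
Milne's DIFFERENCE map.  CONSEQUENCE PROVED HERE (piece P3b-1 of the discharge of `AlbaneseTraceOfFiniteQuotient`, cell
hodgecm-mathlib row VI-5): **every Albanese datum `a : AppendixC.Albanese X'` (Def. 2.3, corepresentability typing) of such an
`X'` whose pieces carry Milne's point-free Albanese data `𝒥 c : Motives.Jacobian (Y c)` is a COCYCLE**
(`AppendixC.Albanese.IsCocycle`, `AppendixC/AlbaneseCocycle.lean`): `α(a,b) · α(b,c) = α(a,c)` for all `T`-points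
`(a,b), (b,c), (a,c)` of `∇X'`.

PROOF (ours): restrict to the open cover `T = ⋃_c a⁻¹(Y_c)`; on `a⁻¹(Y_c)` the three points factor through the lift
`l_c : Y_c × Y_c → ∇X'` of `inj_c × inj_c` (`NablaOfPieces.exists_lift_tensorHom`; the second coordinates lie in `Y_c` because
the pieces `Y_{c'} × Y_{c'}` cover `∇X'`, `exists_tensorHom_left_eq_incl`, and are disjoint), and `l_c ≫ α_{X'}` kills the
diagonal of `Y_c`, so it is `diff_c ≫ ψ_c` for a homomorphism `ψ_c : J_c → Alb_{X'}` (Milne Prop. 6.4) and inherits Milne's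
cocycle identity `diff_cocycle`; morphisms to `Alb_{X'}` that agree on an open cover agree (Mathlib `Scheme.Cover.hom_ext`).

* `Albanese.lift_comp_lift_comp_α_mul` — the cocycle identity in lift form on a piece `Y_c × Y_c → ∇X'`.
* `Nabla.snd_mem_range_of_fst_mem_range` — a point of `∇X'` whose first coordinate lies in the piece `Y_c` has its second
  coordinate in `Y_c`.
* `Albanese.isCocycle_of_isColimit` — **the theorem.**

NOT claimed: the cocycle property over a non-split base (P3b-2: finite Galois descent), transitivity of `∇X'`, the named
fact (T).  HC_CM is NOT proved here; nothing discharges a COR-CM binder.  Ours; axioms `propext`, `Classical.choice`,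
`Quot.sound`.

## References
* [Liu2021] Y. Liu, arXiv:2102.11518 = Camb. J. Math. 9 (2021), §2.1 Def. 2.1 (1) (l. 1171–1176), Proposition with proof
  (l. 1190–1200), Def. 2.3 (l. 1202–1208).
* [Milne1986JacobianVarieties] J. S. Milne, *Jacobian Varieties* (1986), §6 Prop. 6.4, Remark 6.5.
-/

noncomputable section

open CategoryTheory CategoryTheory.Limits AlgebraicGeometry MonoidalCategory CartesianMonoidalCategory
open Literature.AlgebraicGeometry.Motives (SchemeOver AbelianVariety Jacobian)

namespace Literature.NumberTheory.Automorphic.Liu2021.AppendixC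

universe u v

open scoped MonObj

variable {L : Type u} [Field L] {X' : SchemeOver L} {κ : Type v} [Small.{u} κ] {Y : κ → SchemeOver L}
  {inj : ∀ c, Y c ⟶ X'}

omit [Small.{u} κ] in
/-- **The cocycle identity on a piece.**  For an Albanese datum `a` of `X'`, a leg `inj_c : Y_c ⟶ X'` carrying Milne's
point-free Albanese datum `𝒥` and a lift `l : Y_c × Y_c → ∇X'` of `inj_c × inj_c`, the morphism `l ≫ α_{X'}` kills the
diagonal of `Y_c`, hence equals `diff ≫ ψ` for the homomorphism `ψ = 𝒥.desc (l ≫ α)` (Milne Prop. 6.4) and satisfies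
`α(l(p,q)) · α(l(q,r)) = α(l(p,r))` for all `T`-points `p, q, r` of `Y_c`.  Ours. [cite: Milne1986JacobianVarieties, §6 Prop. 6.4, Remark 6.5]
[cite: Liu2021, §2.1 proof of the Proposition (l. 1194–1200)] -/
theorem Albanese.lift_comp_lift_comp_α_mul (a : Albanese X') (c : κ) (𝒥 : Jacobian (Y c))
    (l : Y c ⊗ Y c ⟶ a.nabla.N) (hl : l ≫ a.nabla.incl = inj c ⊗ₘ inj c) {T : SchemeOver L} (p q r : T ⟶ Y c) :
    (lift p q ≫ l ≫ a.α) * (lift q r ≫ l ≫ a.α) = lift p r ≫ l ≫ a.α := by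
  have hdiag : lift (𝟙 (Y c)) (𝟙 (Y c)) ≫ l = inj c ≫ a.nabla.diag := by
    rw [← cancel_mono a.nabla.incl, Category.assoc, hl, lift_map, Category.assoc, a.nabla.diag_incl, comp_lift,
      Category.id_comp, Category.comp_id]
  have h1 : lift (𝟙 (Y c)) (𝟙 (Y c)) ≫ (l ≫ a.α) = 1 := by
    rw [← Category.assoc, hdiag, Category.assoc, a.diag_α, MonObj.comp_one]
  have hfac : 𝒥.diff ≫ (𝒥.desc (l ≫ a.α) h1).hom.hom.hom = l ≫ a.α := 𝒥.fac _ h1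
  have h := congrArg (fun g => lift p (lift q r) ≫ g ≫ (𝒥.desc (l ≫ a.α) h1).hom.hom.hom) 𝒥.diff_cocycle
  simp only [MonObj.mul_comp, MonObj.comp_mul, Category.assoc, comp_lift_assoc, lift_fst, lift_snd_assoc, lift_snd,
    hfac] at h
  exact h

/-- **A point of `∇X'` whose first coordinate lies in the piece `Y_c` has its second coordinate in `Y_c`**: the pieces
`Y_{c'} × Y_{c'}` cover `∇X'` (`exists_tensorHom_left_eq_incl`) and the legs of a coproduct have disjoint images.  Ours.
[cite: Liu2021, §2.1 Def. 2.1 (1) (l. 1171–1174) and proof of the Proposition (l. 1194–1200)] -/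
theorem Nabla.snd_mem_range_of_fst_mem_range [Finite κ] (N : Nabla X') (hcol : IsColimit (Cofan.mk X' inj)) (c : κ)
    (n : N.N.left) (h : (fst X' X').left (N.incl.left n) ∈ Set.range (inj c).left) :
    (snd X' X').left (N.incl.left n) ∈ Set.range (inj c).left := by
  obtain ⟨c', y, hy⟩ := exists_tensorHom_left_eq_incl N hcol n
  have h1 : (fst X' X').left (N.incl.left n) ∈ Set.range (inj c').left := by
    rw [← hy, ← Scheme.Hom.comp_apply, ← Over.comp_left, tensorHom_fst, Over.comp_left, Scheme.Hom.comp_apply]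
    exact ⟨_, rfl⟩
  have hcc : c' = c := by
    by_contra hne
    exact Set.disjoint_left.mp (disjoint_range_left_of_isColimit hcol hne) h1 h
  subst hcc
  rw [← hy, ← Scheme.Hom.comp_apply, ← Over.comp_left, tensorHom_snd, Over.comp_left, Scheme.Hom.comp_apply]
  exact ⟨_, rfl⟩

/-- The first coordinate of a `T`-point of `∇X'` over `(p, q)`, evaluated at a point `w` of `T`, is `p(w)`. Ours.
[cite: Liu2021, §2.1 Def. 2.1 (1) (l. 1171–1174)] -/
private theorem fst_incl_apply (N : Nabla X') {T : SchemeOver L} (p q : T ⟶ X') (pq : T ⟶ N.N)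
    (hpq : pq ≫ N.incl = lift p q) (w : T.left) : (fst X' X').left (N.incl.left (pq.left w)) = p.left w := by
  have : (fst X' X').left (N.incl.left (pq.left w)) = ((pq ≫ N.incl) ≫ fst X' X').left w := by
    simp only [Over.comp_left, Scheme.Hom.comp_apply]
  rw [this, hpq, lift_fst]

/-- The second coordinate of a `T`-point of `∇X'` over `(p, q)`, evaluated at a point `w` of `T`, is `q(w)`. Ours.
[cite: Liu2021, §2.1 Def. 2.1 (1) (l. 1171–1174)] -/
private theorem snd_incl_apply (N : Nabla X') {T : SchemeOver L} (p q : T ⟶ X') (pq : T ⟶ N.N)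
    (hpq : pq ≫ N.incl = lift p q) (w : T.left) : (snd X' X').left (N.incl.left (pq.left w)) = q.left w := by
  have : (snd X' X').left (N.incl.left (pq.left w)) = ((pq ≫ N.incl) ≫ snd X' X').left w := by
    simp only [Over.comp_left, Scheme.Hom.comp_apply]
  rw [this, hpq, lift_snd]

/-- If `(p, q)` is a `T`-point of `∇X'` and `p(w) ∈ Y_c`, then `q(w) ∈ Y_c`. Ours.
[cite: Liu2021, §2.1 proof of the Proposition (l. 1194–1200)] -/
private theorem mem_range_snd_of_mem_range_fst [Finite κ] (N : Nabla X') (hcol : IsColimit (Cofan.mk X' inj)) (c : κ)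
    {T : SchemeOver L} (p q : T ⟶ X') (pq : T ⟶ N.N) (hpq : pq ≫ N.incl = lift p q) (w : T.left)
    (hw : p.left w ∈ Set.range (inj c).left) : q.left w ∈ Set.range (inj c).left := by
  rw [← snd_incl_apply N p q pq hpq w]
  exact N.snd_mem_range_of_fst_mem_range hcol c (pq.left w) (by rwa [fst_incl_apply N p q pq hpq w])

omit [Small.{u} κ] in
/-- A morphism `V → X'` (from an open `V ⊆ T`) with image in the piece `Y_c` lifts to `V → Y_c` over `L` (the leg is an open
immersion). Ours. [cite: Liu2021, §2.1 proof of the Proposition (l. 1194–1200)] -/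
private theorem exists_lift_piece (c : κ) [IsOpenImmersion (inj c).left] {T : SchemeOver L} (V : T.left.Opens)
    (p : T ⟶ X') (hp : ∀ w : T.left, w ∈ V → p.left w ∈ Set.range (inj c).left) :
    ∃ pc : Over.mk (V.ι ≫ T.hom) ⟶ Y c, pc ≫ inj c = Over.homMk V.ι rfl ≫ p := by
  have hsub : Set.range (V.ι ≫ p.left) ⊆ Set.range (inj c).left := by
    rintro _ ⟨z, rfl⟩
    rw [Scheme.Hom.comp_apply]
    refine hp _ ?_
    have hz : V.ι z ∈ Set.range V.ι := ⟨z, rfl⟩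
    rw [Scheme.Opens.range_ι] at hz
    exact hz
  let l₀ := IsOpenImmersion.lift (inj c).left (V.ι ≫ p.left) hsub
  have hl₀ : l₀ ≫ (inj c).left = V.ι ≫ p.left := IsOpenImmersion.lift_fac _ _ _
  refine ⟨Over.homMk l₀ ?_, ?_⟩
  · change l₀ ≫ (Y c).hom = V.ι ≫ T.hom
    rw [← Over.w (inj c), ← Category.assoc, hl₀, Category.assoc, Over.w p]
  · apply Over.OverMorphism.ext
    simp only [Over.comp_left, Over.homMk_left]
    exact hl₀

/-- **[Liu2021, §2.1] The Albanese morphism of a split scheme is a cocycle.**  For ANY field `L`, a colimit cofan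
`inj_c : Y_c ⟶ X'` (`κ` finite) of geometrically irreducible `L`-schemes carrying Milne's point-free Albanese data
`𝒥 c : Jacobian (Y c)`, and ANY Albanese datum `a : Albanese X'` (Def. 2.3), the Albanese morphism `α_{X'}` satisfies the
cocycle identity `α(a,b) · α(b,c) = α(a,c)` on all `T`-points of `∇X'` (`Albanese.IsCocycle`).  Ours (the component-wise
content of «Serre's construction» in Liu's proof, l. 1194–1200, for the abstract corepresenting datum).
[cite: Liu2021, §2.1 Proposition with proof (l. 1190–1200), Def. 2.3 (l. 1202–1208)] [cite: Milne1986JacobianVarieties, §6 Prop. 6.4, Remark 6.5] -/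
theorem Albanese.isCocycle_of_isColimit [Finite κ] (a : Albanese X') (hcol : IsColimit (Cofan.mk X' inj))
    (𝒥 : ∀ c, Jacobian (Y c)) (hirr : ∀ c, GeometricallyIrreducible (Y c).hom) : a.IsCocycle := by
  classical
  haveI := hirr
  haveI := fun c => isOpenImmersion_left_of_isColimit hcol c
  intro T p q r pq qr pr hpq hqr hpr
  -- lifts of the pieces `Y_c × Y_c → ∇X'`
  choose l hl using fun c => exists_lift_tensorHom (inj := inj) a.nabla c
  -- the open cover `T = ⋃_c p⁻¹(Y_c)`
  set R : κ → Set X'.left := fun c => Set.range (inj c).left with hR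
  have hRo : ∀ c, IsOpen (R c) := fun c => (isClopen_range_left_of_isColimit hcol c).2
  let V : κ → T.left.Opens := fun c => ⟨p.left ⁻¹' R c, (hRo c).preimage p.left.continuous⟩
  have hV : TopologicalSpace.IsOpenCover V := by
    refine TopologicalSpace.IsOpenCover.mk (eq_top_iff.2 fun w _ => ?_)
    obtain ⟨c, y, hy⟩ := exists_eq_left_of_isColimit hcol (p.left w)
    exact TopologicalSpace.Opens.mem_iSup.2 ⟨c, show p.left w ∈ R c from ⟨y, hy⟩⟩
  -- it suffices to check the identity on each `p⁻¹(Y_c)`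
  apply Over.OverMorphism.ext
  refine Scheme.Cover.hom_ext (T.left.openCoverOfIsOpenCover V hV) _ _ fun c => ?_
  rw [Scheme.openCoverOfIsOpenCover_f]
  change (V c).ι ≫ _ = (V c).ι ≫ _
  -- the three points restricted to `p⁻¹(Y_c)` factor through `Y_c × Y_c`
  set Tc : SchemeOver L := Over.mk ((V c).ι ≫ T.hom)
  set ιc : Tc ⟶ T := Over.homMk (V c).ι rfl
  have hpV : ∀ w : T.left, w ∈ V c → p.left w ∈ Set.range (inj c).left := fun w hw => hw
  have hqV : ∀ w : T.left, w ∈ V c → q.left w ∈ Set.range (inj c).left := fun w hw =>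
    mem_range_snd_of_mem_range_fst a.nabla hcol c p q pq hpq w (hpV w hw)
  have hrV : ∀ w : T.left, w ∈ V c → r.left w ∈ Set.range (inj c).left := fun w hw =>
    mem_range_snd_of_mem_range_fst a.nabla hcol c q r qr hqr w (hqV w hw)
  obtain ⟨pc, hpc⟩ := exists_lift_piece c (V c) p hpV
  obtain ⟨qc, hqc⟩ := exists_lift_piece c (V c) q hqV
  obtain ⟨rc, hrc⟩ := exists_lift_piece c (V c) r hrV
  have key : ∀ (u v : T ⟶ X') (uv : T ⟶ a.nabla.N) (huv : uv ≫ a.nabla.incl = lift u v) (uc vc : Tc ⟶ Y c),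
      uc ≫ inj c = ιc ≫ u → vc ≫ inj c = ιc ≫ v → ιc ≫ uv = lift uc vc ≫ l c := by
    intro u v uv huv uc vc huc hvc
    rw [← cancel_mono a.nabla.incl, Category.assoc, huv, comp_lift, Category.assoc, hl, lift_map, huc, hvc]
  have H : ιc ≫ ((pq ≫ a.α) * (qr ≫ a.α)) = ιc ≫ (pr ≫ a.α) := by
    rw [MonObj.comp_mul, ← Category.assoc, ← Category.assoc, ← Category.assoc,
      key p q pq hpq pc qc hpc hqc, key q r qr hqr qc rc hqc hrc, key p r pr hpr pc rc hpc hrc,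
      Category.assoc, Category.assoc, Category.assoc]
    exact a.lift_comp_lift_comp_α_mul c (𝒥 c) (l c) (hl c) pc qc rc
  have H' := congrArg CommaMorphism.left H
  simp only [Over.comp_left, Over.homMk_left, ιc] at H'
  exact H'

end Literature.NumberTheory.Automorphic.Liu2021.AppendixC

end
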